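import Mathlib
import Summits.Ventures.PercRepro2.Defs
import Summits.Ventures.PercRepro2.Graph
import Summits.Ventures.PercRepro2.OneColourSwitch
import Summits.Ventures.PercRepro2.RegionHubSign
import Summits.Ventures.PercRepro2.SideSwitch
import Summits.Ventures.PercRepro2.TermSwitchDefs
import Summits.Ventures.PercRepro2.M9NoPocketDefs
import Summits.Ventures.PercRepro2.M9PsiOneDefs
import Summits.Ventures.PercRepro2.M9PsiOneWorlds
import Summits.Ventures.PercRepro2.M9PsiOneLink
import Summits.Ventures.PercRepro2.M9PsiOneInj
import Summits.Ventures.PercRepro2.M9PsiTwoDefs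
import Summits.Ventures.PercRepro2.M9PsiTwoWorlds
import Summits.Ventures.PercRepro2.M9PsiTwoNoLink
import Summits.Ventures.PercRepro2.M9PsiTwoLink
import Summits.Ventures.PercRepro2.M9PsiTwoSigma
import Summits.Ventures.PercRepro2.M9PsiTwoDirty
import Summits.Ventures.PercRepro2.M9PsiTwoUnrooted
import Summits.Ventures.PercRepro2.M9PsiTwoRooted
import Summits.Ventures.PercRepro2.M9PsiTwoRootedY

/-!
# The direct flipped vertices of `Ψ₂ ω` are visible in the image — the pure case (blind cell
PercRepro2, p3 g34, 2026-08-29; `proofs/P3-REST2.md` §1, claim (iv), third step)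

In the PURE case (the `W`-link of `ω` runs through `d`) the image has no `Y`-linking vertex
(`PureY_psiTwo_of_pure`), while a non-pure source gives one (`not_PureY_psiTwo_of_not_pure`):
the image tells the two cases apart.  The dead ends of a pure image are rooted at the root of
`d` (`deadRoot_psiTwo_of_pure`), so the vertices whose `d`-edge `Ψ₂` flipped are the
same-joined ones rooted at the other root (`oppJoined`).  Hence the full reconstruction set
`RsetP = Rset ∪ {pure image ∧ oppJoined}` is the set of direct flipped vertices in BOTH cases
(`RsetP_psiTwo_eq`).  Own work; std axioms.
-/

namespace Summit.Ventures.PercRepro2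

namespace NoPocket

open Finset Classical RegionHub OneColourSwitch SideSwitch TermSwitch

variable {V : Type*} {E : Type*}

section Pure

variable {ends : E → Sym2 V} {p q r s d : V} {ω : Config E}

variable (h : IsEX ends p q r s d ω)
include h

/-- **In the pure case the image has no `Y`-linking vertex** (no edge `r–s`, `r ≁_Y s`). -/
theorem PureY_psiTwo_of_pure (hrs : ∀ e, ends e ≠ s(r, s)) (hY : ¬ Conn ends ω r s)
    (hp : PureW ends r s d ω) : PureY ends r s d (psiTwo ends r s d ω) := by
  intro y hy
  rcases Kcore_psiTwo_cases h hy.1 with hyK | ⟨hyF, _⟩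
  · -- a `Y`-core vertex of `ω`: its block stays in the `Y`-core, the link transfers to `ω`
    have hsub := blockIn_psiTwo_subset_Kcore h hyK
    have hc : Conn ends (restrictTo ends ω
        (blockIn ends (Kcore ends r s d (psiTwo ends r s d ω)) y ∪ {r, s})) r s :=
      conn_restrictTo_transfer (fun e a b hab ha hb hends =>
        (psiTwo_eq_on_Kcore h hsub e a b hab ha hb hends)) hy.2
    exact hY (conn_mono restrictTo_le hc)
  · -- a direct flipped vertex: its image block lies in its old block; the `Y`-link is an old
    -- `W`-link: the vertex is `W`-linking, against purity
    have h1 : Conn ends (restrictTo ends (psiTwo ends r s d ω)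
        (blockIn ends (Mcore ends r s d ω) y ∪ {r, s})) r s :=
      conn_mono (restrictTo_mono (Set.union_subset_union_left _
        (blockIn_psiTwo_subset_blockIn h hyF))) hy.2
    have h2 : Conn ends (restrictTo ends (OneColourSwitch.compl ω)
        (blockIn ends (Mcore ends r s d ω) y ∪ {r, s})) r s :=
      conn_restrictTo_transfer (fun e a b hab ha hb hends =>
        (psiTwo_eq_not_on_block h hrs hyF e a b hab ha hb hends).symm) h1
    exact hp y ⟨flipSetW_subset_Mcore hyF, h2⟩

/-- **In the non-pure case the image has a `Y`-linking vertex** (no edge `r–s`): the first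
vertex of the `W`-link inside a linking block is direct and carries the link in the image. -/
theorem not_PureY_psiTwo_of_not_pure (hrs : ∀ e, ends e ≠ s(r, s))
    (hp : ¬ PureW ends r s d ω) : ¬ PureY ends r s d (psiTwo ends r s d ω) := by
  intro hPY
  obtain ⟨x, hx⟩ := not_forall.mp hp
  have hxL : linkingW ends r s d ω x := not_not.mp hx
  have hxF : x ∈ flipSetW ends r s d ω := Or.inr hxL
  have hxM := hxL.1
  let B := blockIn ends (Mcore ends r s d ω) x
  -- the closed set: `r`; old-block vertices direct and `Y`-rooted at `r` in the image inside
  -- their block; `s` once a linking vertex exists; old-block vertices rooted at `s` once a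
  -- linking vertex exists
  let L : Prop := ∃ y, linkingY ends r s d (psiTwo ends r s d ω) y
  let T : Set V := {v | v = r ∨
    (v ∈ B ∧ directW ends r s d ω v ∧ rootedY ends r s d (psiTwo ends r s d ω) r v) ∨
    (v = s ∧ L) ∨
    (v ∈ B ∧ directW ends r s d ω v ∧ rootedY ends r s d (psiTwo ends r s d ω) s v ∧ L)}
  have closed : ∀ z ∈ T, ∀ y,
      (openGraph ends (restrictTo ends (OneColourSwitch.compl ω) (B ∪ {r, s}))).Adj z y → y ∈ T := by
    intro z hz y hzy
    obtain ⟨hne, e, he, hends⟩ := openGraph_adj.1 hzy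
    unfold restrictTo at he
    by_cases hw : e ∈ within ends (B ∪ {r, s})
    · rw [if_pos hw] at he
      have hω : ω e = false := by simpa [OneColourSwitch.compl] using he
      obtain ⟨u, hu, v, hv, huv⟩ := hw
      have hzy' : z ∈ B ∪ {r, s} ∧ y ∈ B ∪ {r, s} := by
        rw [hends, Sym2.eq_iff] at huv
        rcases huv with ⟨h1, h2⟩ | ⟨h1, h2⟩
        · rw [h1, h2]; exact ⟨hu, hv⟩
        · rw [h1, h2]; exact ⟨hv, hu⟩
      have he' : psiTwo ends r s d ω e = true := by
        rw [← psiTwo_eq_not_on_block h hrs hxF e z y hne hzy'.1 hzy'.2 hends]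
        simp [OneColourSwitch.compl, hω]
      rcases hzy'.2 with hyB | hyT
      · have hyM : y ∈ Mcore ends r s d ω := mem_Mcore_of_mem_blockIn hxM hyB
        have hyF : y ∈ flipSetW ends r s d ω := blockIn_subset_flipSetW hxF hyB
        -- the one-edge root through a terminal `t`, and the step inside an image block
        have step : ∀ z' t, z' ∈ B → directW ends r s d ω z' →
            rootedY ends r s d (psiTwo ends r s d ω) t z' → z' = z →
            directW ends r s d ω y ∧ rootedY ends r s d (psiTwo ends r s d ω) t y := by
          intro z' t hz'B hz'D hz'R hzz
          subst hzz
          have hyD : directW ends r s d ω y := directW_of_edge hz'D hyM hends hω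
          have hzK := mem_Kcore_psiTwo_of_directW h hrs (blockIn_subset_flipSetW hxF hz'B) hz'D
          have hyK := mem_Kcore_psiTwo_of_directW h hrs hyF hyD
          have hblk : blockIn ends (Kcore ends r s d (psiTwo ends r s d ω)) z' =
              blockIn ends (Kcore ends r s d (psiTwo ends r s d ω)) y :=
            blockIn_eq_of_conn (conn_allIn_of_edge hzK hyK hends)
          have hstep : Conn ends (restrictTo ends (psiTwo ends r s d ω)
              (blockIn ends (Kcore ends r s d (psiTwo ends r s d ω)) z' ∪ {r, s})) z' y := by
            refine conn_of_openAdj ⟨e, ?_, hends⟩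
            rw [restrictTo_eq (S := blockIn ends (Kcore ends r s d (psiTwo ends r s d ω)) z' ∪ {r, s})
              (Or.inl (mem_blockIn_self _ _)) (Or.inl (hblk ▸ mem_blockIn_self _ _)) hends]
            exact he'
          exact ⟨hyD, hyK, by rw [← hblk]; exact conn_trans hz'R.2 hstep⟩
        have term : ∀ t, t = r ∨ t = s → z = t →
            directW ends r s d ω y ∧ rootedY ends r s d (psiTwo ends r s d ω) t y := by
          intro t ht hzt
          subst hzt
          have hyD : directW ends r s d ω y := directW_of_term_edge ht hyM hends hω
          have hyK := mem_Kcore_psiTwo_of_directW h hrs hyF hyD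
          refine ⟨hyD, hyK, conn_of_openAdj ⟨e, ?_, hends⟩⟩
          rw [restrictTo_eq (S := blockIn ends (Kcore ends r s d (psiTwo ends r s d ω)) y ∪ {r, s})
            (by rcases ht with rfl | rfl <;> simp) (Or.inl (mem_blockIn_self _ _)) hends]
          exact he'
        rcases hz with hz | ⟨hzB, hzD, hzR⟩ | ⟨hz, hL⟩ | ⟨hzB, hzD, hzR, hL⟩
        · obtain ⟨hyD, hyR⟩ := term r (Or.inl rfl) hz
          exact Or.inr (Or.inl ⟨hyB, hyD, hyR⟩)
        · obtain ⟨hyD, hyR⟩ := step z r hzB hzD hzR rfl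
          exact Or.inr (Or.inl ⟨hyB, hyD, hyR⟩)
        · obtain ⟨hyD, hyR⟩ := term s (Or.inr rfl) hz
          exact Or.inr (Or.inr (Or.inr ⟨hyB, hyD, hyR, hL⟩))
        · obtain ⟨hyD, hyR⟩ := step z s hzB hzD hzR rfl
          exact Or.inr (Or.inr (Or.inr ⟨hyB, hyD, hyR, hL⟩))
      · -- `y` is a terminal
        simp only [Set.mem_insert_iff, Set.mem_singleton_iff] at hyT
        rcases hyT with hy | hy
        · exact Or.inl hy
        · -- `y = s`: a linking vertex exists if `z` is rooted at `r` inside its image block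
          rcases hz with hz | ⟨hzB, hzD, hzR⟩ | ⟨hz, hL⟩ | ⟨_, _, _, hL⟩
          · exact (hrs e (by rw [hends, hz, hy])).elim
          · have hzK := mem_Kcore_psiTwo_of_directW h hrs (blockIn_subset_flipSetW hxF hzB) hzD
            have hlink : Conn ends (restrictTo ends (psiTwo ends r s d ω)
                (blockIn ends (Kcore ends r s d (psiTwo ends r s d ω)) z ∪ {r, s})) r y := by
              refine conn_trans hzR.2 (conn_of_openAdj ⟨e, ?_, hends⟩)
              rw [restrictTo_eq (S := blockIn ends (Kcore ends r s d (psiTwo ends r s d ω)) z ∪ {r, s})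
                (Or.inl (mem_blockIn_self _ _)) (Or.inr (by rw [hy]; simp)) hends]
              exact he'
            rw [hy] at hlink
            exact Or.inr (Or.inr (Or.inl ⟨hy, z, hzK, hlink⟩))
          · exact Or.inr (Or.inr (Or.inl ⟨hy, hL⟩))
          · exact Or.inr (Or.inr (Or.inl ⟨hy, hL⟩))
    · rw [if_neg hw] at he; exact absurd he Bool.false_ne_true
  have key : s ∈ T := mem_of_conn_of_closed closed (Or.inl rfl) hxL.2
  rcases key with hk | ⟨hkB, _, _⟩ | ⟨_, hL⟩ | ⟨hkB, _, _, _⟩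
  · exact h.hrs hk.symm
  · exact term_not_mem_Mcore (Or.inr rfl) (mem_Mcore_of_mem_blockIn hxM hkB)
  · obtain ⟨y, hy⟩ := hL
    exact hPY y hy
  · exact term_not_mem_Mcore (Or.inr rfl) (mem_Mcore_of_mem_blockIn hxM hkB)

omit h in
/-- In the pure case every flipped vertex is joined (no `W`-linking vertex). -/
lemma mem_joinedW_of_pure (hp : PureW ends r s d ω) {x : V} (hx : x ∈ flipSetW ends r s d ω) :
    x ∈ joinedW ends r s d ω := by
  rcases hx with hx | hx
  · exact hx
  · exact (hp x hx).elim

/-- **The dead ends of a pure image are rooted at the root of `d`** (no edge `r–s`, `r ~_W s`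
in `ω`): `deadRoot (Ψ₂ ω) = r` iff `d ~_Y r` in `ω`. -/
theorem deadRoot_psiTwo_of_pure (hrs : ∀ e, ends e ≠ s(r, s)) (hp : PureW ends r s d ω)
    (hc : Conn ends (OneColourSwitch.compl ω) r s) :
    deadRoot ends r s d (psiTwo ends r s d ω) = if Conn ends ω d r then r else s := by
  unfold deadRoot
  by_cases hdr : Conn ends ω d r
  · -- a dead end rooted at `r`: the `r`-rooted `W`-neighbour of `d`, its `d`-edge kept
    have hopp : oppRoot ends r s d ω = s := by unfold oppRoot; rw [if_pos hdr]
    obtain ⟨x, e, hx, hends, hω⟩ := exists_rooted_nbr h hrs hp hc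
    have hxJ : x ∈ joinedW ends r s d ω := mem_joinedW_of_nbr hx.1 (ends_swap hends)
    have hkept : psiTwo ends r s d ω e = false := by
      rw [psiTwo_d_joinedW_kept (ends_swap hends) (fun hs' => ?_), hω]
      rw [hopp] at hs'
      exact hp x (linkingW_of_rootedW_both hx hs')
    have hroot := (rootedY_psiTwo_of_pure h hrs hp (Or.inl ⟨rfl, rfl⟩) (Or.inl hxJ) hx).1
    rw [if_pos ⟨x, e, hends, hkept, hroot⟩, if_pos hdr]
  · -- no dead end is rooted at `r`: a `W`-neighbour of `d` in the image `Y`-core rooted at `r`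
    -- would be a flipped vertex rooted at `oppRoot = r`, whose `d`-edge is flipped open
    have hopp : oppRoot ends r s d ω = r := by unfold oppRoot; rw [if_neg hdr]
    rw [if_neg hdr, if_neg]
    rintro ⟨x, e, hends, he, hroot⟩
    rcases Kcore_psiTwo_cases h hroot.1 with hxK | ⟨hxF, _⟩
    · rw [psiTwo_d_Kcore h hxK (ends_swap hends), edge_Kcore_d h hxK hends] at he
      exact Bool.false_ne_true he.symm
    · have hr := rootedW_of_rootedY_psiTwo h hrs hxF hroot
      have hxJ := mem_joinedW_of_pure hp hxF
      rw [psiTwo_d_opp_eq_true h hp hxJ (ends_swap hends) (by rw [hopp]; exact hr)] at he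
      exact Bool.false_ne_true he.symm

/-- In the pure case the root opposite to the dead ends of the image is `oppRoot` (no edge
`r–s`, `r ~_W s` in `ω`). -/
theorem oppDeadRoot_psiTwo_of_pure (hrs : ∀ e, ends e ≠ s(r, s)) (hp : PureW ends r s d ω)
    (hc : Conn ends (OneColourSwitch.compl ω) r s) :
    oppDeadRoot ends r s d (psiTwo ends r s d ω) = oppRoot ends r s d ω := by
  unfold oppDeadRoot oppRoot
  rw [deadRoot_psiTwo_of_pure h hrs hp hc]
  by_cases hdr : Conn ends ω d r
  · rw [if_pos hdr, if_pos rfl, if_pos hdr]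
  · rw [if_neg hdr, if_neg h.hrs.symm, if_neg hdr]

/-- **The full reconstruction set of the image is the set of direct flipped vertices** (no
edge `r–s`, `r ≁_Y s`, `r ~_W s` in `ω`; both cases). -/
theorem RsetP_psiTwo_eq (hrs : ∀ e, ends e ≠ s(r, s)) (hY : ¬ Conn ends ω r s)
    (hc : Conn ends (OneColourSwitch.compl ω) r s) :
    RsetP ends r s d (psiTwo ends r s d ω) =
      {z | z ∈ flipSetW ends r s d ω ∧ directW ends r s d ω z} := by
  ext x
  constructor
  · rintro (hx | ⟨hxK, hPY, hopp⟩)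
    · rcases Kcore_psiTwo_cases h hx.1 with hK | hR
      · exact (not_mem_Rset_of_mem_Kcore h hrs hY hK hx).elim
      · exact hR
    · rcases Kcore_psiTwo_cases h hxK with hK | hR
      · -- a `Y`-core vertex of `ω` cannot be opp-joined: it would give a `Y`-link through `d`
        exfalso
        have hp : PureW ends r s d ω := by
          by_contra hp
          exact not_PureY_psiTwo_of_not_pure h hrs hp hPY
        obtain ⟨y, hy, ⟨e, hends, he⟩, hroot⟩ := hopp
        rw [oppDeadRoot_psiTwo_of_pure h hrs hp hc] at hroot
        have hsub := blockIn_psiTwo_subset_Kcore h hK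
        have hyK : y ∈ Kcore ends r s d ω := hsub hy
        have hblk : blockIn ends (Kcore ends r s d (psiTwo ends r s d ω)) x =
            blockIn ends (Kcore ends r s d (psiTwo ends r s d ω)) y := blockIn_eq_of_conn hy
        have hroot' : Conn ends (restrictTo ends (psiTwo ends r s d ω)
            (blockIn ends (Kcore ends r s d (psiTwo ends r s d ω)) x ∪ {r, s}))
            (oppRoot ends r s d ω) y := by
          rw [hblk]; exact hroot.2
        -- `y ~_Y oppRoot` in `ω`
        have hc1 : Conn ends (restrictTo ends ω
            (blockIn ends (Kcore ends r s d (psiTwo ends r s d ω)) x ∪ {r, s}))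
            (oppRoot ends r s d ω) y :=
          conn_restrictTo_transfer (fun e a b hab ha hb hends =>
            (psiTwo_eq_on_Kcore h hsub e a b hab ha hb hends)) hroot'
        have hc2 : Conn ends ω (oppRoot ends r s d ω) y := conn_mono restrictTo_le hc1
        have hyd : Conn ends ω y d := by
          refine conn_of_openAdj ⟨e, ?_, hends⟩
          rw [← psiTwo_d_Kcore h hyK (ends_swap hends)]; exact he
        have hdo : Conn ends ω d (oppRoot ends r s d ω) := conn_symm (conn_trans hc2 hyd)
        unfold oppRoot at hdo
        by_cases hdr : Conn ends ω d r
        · rw [if_pos hdr] at hdo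
          exact hY (conn_trans (conn_symm hdr) hdo)
        · rw [if_neg hdr] at hdo
          exact hdr hdo
      · exact hR
  · rintro ⟨hxF, hxD⟩
    by_cases hp : PureW ends r s d ω
    · -- pure: `U`-adjacent, or the old block in the image block with a `W`-neighbour of `d`
      rcases blockIn_subset_or_adjUset h hrs hxF hxD with hadj | hold
      · exact Or.inl ⟨mem_Kcore_psiTwo_of_directW h hrs hxF hxD, Or.inr (Or.inr hadj)⟩
      obtain ⟨y₀, ⟨hy₀M, e₀, hends₀⟩, hc₀⟩ := mem_joinedW_of_pure hp hxF
      have hy₀Q := hold (conn_symm hc₀)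
      have hy₀J : y₀ ∈ joinedW ends r s d ω := mem_joinedW_of_nbr hy₀M hends₀
      by_cases hy₀o : rootedW ends r s d ω (oppRoot ends r s d ω) y₀
      · -- the `d`-edge is flipped open: the block is opp-joined
        refine Or.inr ⟨mem_Kcore_psiTwo_of_directW h hrs hxF hxD,
          PureY_psiTwo_of_pure h hrs hY hp, y₀, hy₀Q, ⟨e₀, ends_swap hends₀,
            psiTwo_d_opp_eq_true h hp hy₀J hends₀ hy₀o⟩, ?_⟩
        rw [oppDeadRoot_psiTwo_of_pure h hrs hp hc]
        have ht : oppRoot ends r s d ω = r ∧ s = s ∨ oppRoot ends r s d ω = s ∧ r = r := by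
          unfold oppRoot
          by_cases hdr : Conn ends ω d r
          · rw [if_pos hdr]; exact Or.inr ⟨rfl, rfl⟩
          · rw [if_neg hdr]; exact Or.inl ⟨rfl, rfl⟩
        rcases ht with ⟨h1, _⟩ | ⟨h1, _⟩
        · exact (rootedY_psiTwo_of_pure h hrs hp (Or.inl ⟨h1, rfl⟩) (Or.inl hy₀J) hy₀o).1
        · exact (rootedY_psiTwo_of_pure h hrs hp (Or.inr ⟨h1, rfl⟩) (Or.inl hy₀J) hy₀o).1
      · -- the `d`-edge is kept closed: dead-joined
        refine Or.inl ⟨mem_Kcore_psiTwo_of_directW h hrs hxF hxD, Or.inl ⟨y₀, hy₀Q, e₀,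
          ends_swap hends₀, ?_⟩⟩
        rw [psiTwo_d_joinedW_kept hends₀ hy₀o]
        exact edge_Mcore_d h hy₀M (ends_swap hends₀)
    · exact Or.inl (mem_Rset_of_directW h hrs hp hxF hxD)

end Pure

end NoPocket

end Summit.Ventures.PercRepro2
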